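import Summits.CriticalPhenomena.PercolationContinuityZ3.Theorems.PercNearOneGluingNoHeavyQuantSixDisplays
import HarnessLib

/-!
# QUANT lane / PAPER-2 rate track (ARM-2 = constants bookkeeper, gen 4): the Peierls constant `2⁻⁶` in the dimensions `d = 7, 8, 9, 10` —
# orbit defects `η(2⁻⁶, d)` to the last binary digit and the numeral displays `π_{p_c(ℤ^d)}(N) ≤ (1 − 2^{−a_d})^⌊(log*₂ N − 6)/2⌋`,
# `a₇ = 94896`, `a₈ = 218296`, `a₉ = 493968`, `a₁₀ = 1103338`

builds on p205010 (kernel theorem, internal audit signed; external expert review pending)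

Cell `prim-quant`, seat `prim-quant-arm-2` (`run/shared/lean/prim/quant/prim-quant-arm-2/RATE-CONSTANTS.md` §2e/§2f).  Completes the `2⁻⁶` table of
`…QuantSixDisplays` (p250116: `d = 3..6` sharp, `a_d = 2446, 6605, 16680, 40374`, and every `3 ≤ d ≤ 32` in closed form) over the remaining
"first explicit rate" dimensions `d = 7..10`, in the pattern of `…QuantPkOrbitMidD` (p249293, the same rows at `2⁻⁸`: `106167, 244058, 551931, 1232145`):

* orbit defects (generic cast form `EpsSharp.epsOrbitDefect_half_pow_castForm` at `K(2⁻⁶) = 12777`, two kernel-decided integer comparisons each; interval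
  values of `log₂(1/η)`: `94895.44`, `218295.88`, `493967.45`, `1103337.59`): `orbit_six_seven_sharp : (1/2)^94896 < η(2⁻⁶,7) < (1/2)^94895`,
  `orbit_six_eight_sharp` (`218296/218295`), `orbit_six_nine_sharp` (`493968/493967`), `orbit_six_ten_sharp` (`1103338/1103337`);
* displays (ARM-1's `sixScaleDefect_criticalProbI_orbit` p249527 + bridge `epsLHi_le_knLHi` p249770 + `knShiftC_eq_six_of_le32` p249070 through the schema p246289):
  `oneArm_rate_Z7/Z8/Z9/Z10_six_sharp : π_{p_c(ℤ^d)}(N) ≤ (1 − 2^{−a_d})^⌊(log*₂ N − 6)/2⌋` and the two-sided `θ` forms (`8d² = 392, 512, 648, 800`).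

Second derivation: `run/sessions/prover-prim-quant-arm-2-g4-0/folder/code/eps_table.py` (exact integers).  HONEST SENTENCE (unchanged): the proved rate at
`p_c(ℤ^d)`, `d ≥ 3`, is of iterated-logarithm type — explicit functions tending to `0` and nothing more; class log*; the display-of-record ruling is the lane
lead's; polylog / power law OPEN.  No definitions, no sorries; standard axioms.  [cite: KozmaNitzan2024, §4 Theorem 6 (pp. 25–31)]
[cite: DuminilcopinKozmaTassion2020, Proposition 1]
-/

noncomputable section

namespace Summit.CriticalPhenomena.PercolationContinuityZ3.Theorems.Quant.EpsSharp

open MeasureTheory Literature.Probability.Percolation Literature.Probability.LatticeModels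

/-! ## Orbit defects `η(2⁻⁶, d)`, `d = 7, 8, 9, 10`, to the last binary digit -/

/-- **`d = 7`, `a = 6`: `(1/2)^94896 < η(2⁻⁶, 7) < (1/2)^94895`** (interval value `log₂(1/η) = 94895.44`; at `2⁻⁸`: `106166.05`). [folklore] (numeric) -/
theorem orbit_six_seven_sharp :
    (1 / 2 : ℝ) ^ 94896 < epsOrbitDefect ((1 / 2 : ℝ) ^ 6) 7 ∧ epsOrbitDefect ((1 / 2 : ℝ) ^ 6) 7 < (1 / 2 : ℝ) ^ 94895 := by
  rw [epsOrbitDefect_half_pow_castForm (by norm_num) 6]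
  exact one_div_sandwich_of_nat (A := 2 ^ (7 * 2 ^ 7)) (C := 2 ^ (2 * 6) * ((96 * (7 + 1)) ^ 2 * 200)) (Klo := 12777) (Khi := 12777)
    (K := epsK ((1 / 2 : ℝ) ^ 6)) (n := 2 * (7 * 2 ^ 7)) (a := 94895) (by positivity) (by positivity) (by norm_num)
    epsK_six_eq.ge epsK_six_eq.le (by decide +kernel) (by decide +kernel)

/-- **`d = 8`, `a = 6`: `(1/2)^218296 < η(2⁻⁶, 8) < (1/2)^218295`** (interval value `218295.88`; at `2⁻⁸`: `244057.29`). [folklore] (numeric) -/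
theorem orbit_six_eight_sharp :
    (1 / 2 : ℝ) ^ 218296 < epsOrbitDefect ((1 / 2 : ℝ) ^ 6) 8 ∧ epsOrbitDefect ((1 / 2 : ℝ) ^ 6) 8 < (1 / 2 : ℝ) ^ 218295 := by
  rw [epsOrbitDefect_half_pow_castForm (by norm_num) 6]
  exact one_div_sandwich_of_nat (A := 2 ^ (8 * 2 ^ 8)) (C := 2 ^ (2 * 6) * ((96 * (8 + 1)) ^ 2 * 200)) (Klo := 12777) (Khi := 12777)
    (K := epsK ((1 / 2 : ℝ) ^ 6)) (n := 2 * (8 * 2 ^ 8)) (a := 218295) (by positivity) (by positivity) (by norm_num)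
    epsK_six_eq.ge epsK_six_eq.le (by decide +kernel) (by decide +kernel)

/-- **`d = 9`, `a = 6`: `(1/2)^493968 < η(2⁻⁶, 9) < (1/2)^493967`** (interval value `493967.45`; at `2⁻⁸`: `551930.62`). [folklore] (numeric) -/
theorem orbit_six_nine_sharp :
    (1 / 2 : ℝ) ^ 493968 < epsOrbitDefect ((1 / 2 : ℝ) ^ 6) 9 ∧ epsOrbitDefect ((1 / 2 : ℝ) ^ 6) 9 < (1 / 2 : ℝ) ^ 493967 := by
  rw [epsOrbitDefect_half_pow_castForm (by norm_num) 6]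
  exact one_div_sandwich_of_nat (A := 2 ^ (9 * 2 ^ 9)) (C := 2 ^ (2 * 6) * ((96 * (9 + 1)) ^ 2 * 200)) (Klo := 12777) (Khi := 12777)
    (K := epsK ((1 / 2 : ℝ) ^ 6)) (n := 2 * (9 * 2 ^ 9)) (a := 493967) (by positivity) (by positivity) (by norm_num)
    epsK_six_eq.ge epsK_six_eq.le (by decide +kernel) (by decide +kernel)

/-- **`d = 10`, `a = 6`: `(1/2)^1103338 < η(2⁻⁶, 10) < (1/2)^1103337`** (interval value `1103337.59`; at `2⁻⁸`: `1232144.64`). [folklore] (numeric) -/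
theorem orbit_six_ten_sharp :
    (1 / 2 : ℝ) ^ 1103338 < epsOrbitDefect ((1 / 2 : ℝ) ^ 6) 10 ∧ epsOrbitDefect ((1 / 2 : ℝ) ^ 6) 10 < (1 / 2 : ℝ) ^ 1103337 := by
  rw [epsOrbitDefect_half_pow_castForm (by norm_num) 6]
  exact one_div_sandwich_of_nat (A := 2 ^ (10 * 2 ^ 10)) (C := 2 ^ (2 * 6) * ((96 * (10 + 1)) ^ 2 * 200)) (Klo := 12777) (Khi := 12777)
    (K := epsK ((1 / 2 : ℝ) ^ 6)) (n := 2 * (10 * 2 ^ 10)) (a := 1103337) (by positivity) (by positivity) (by norm_num)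
    epsK_six_eq.ge epsK_six_eq.le (by decide +kernel) (by decide +kernel)

/-! ## Displays `d = 7, 8, 9, 10` at the Peierls constant `2⁻⁶` -/

/-- **`ℤ⁷` at `2⁻⁶`**: `π_{p_c(ℤ⁷)}(N) ≤ (1 − 2⁻⁹⁴⁸⁹⁶)^⌊(log*₂ N − 6)/2⌋` (at `2⁻⁸`: `2⁻¹⁰⁶¹⁶⁷`, p249293).  An explicit function tending to `0` and nothing more.
builds on p205010 (kernel theorem, internal audit signed; external expert review pending). [cite: KozmaNitzan2024, §4 Theorem 6] -/
theorem oneArm_rate_Z7_six_sharp (N : ℕ) :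
    oneArmProb 7 (criticalProbI 7) N ≤ (1 - (1 / 2 : ℝ) ^ 94896) ^ ((logStar 2 N - 6) / 2) :=
  PkSharp.oneArm_le_base_pow_of_scaleDefect (by norm_num) (sixScaleDefect_criticalProbI_orbit (d := 7) (by norm_num)) (fun m => le_epsLHi _ 7 m)
    (fun m => epsLHi_le_knLHi (d := 7) (by norm_num) knEps_le_half_pow_six (by norm_num) m) (by positivity) orbit_six_seven_sharp.1.le
    (epsOrbitDefect_half_pow_le_one (by norm_num) 6) (knShiftC_eq_six_of_le32 (d := 7) (by norm_num) (by norm_num)).le N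

/-- **`ℤ⁷` at `2⁻⁶`, `θ` two-sided**: `p − p_c ≤ θ(p) ≤ 2(1 − 2⁻⁹⁴⁸⁹⁶)^⌊(log*₂ n − 6)/2⌋ + 392(2n+1)⁷(p − p_c)²` on `[p_c, p_c + 1/4]`.
builds on p205010 (kernel theorem, internal audit signed; external expert review pending). [cite: DuminilCopinTassionEM2016, Thm. 1.1(2)] -/
theorem theta_two_sided_Z7_six_sharp (p : unitInterval) (hpc : (criticalProbI 7 : ℝ) ≤ p) (hp : (p : ℝ) ≤ criticalProbI 7 + 1 / 4) (n : ℕ) :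
    (p : ℝ) - criticalProbI 7 ≤ theta (zdGraph 7) 0 p ∧
      theta (zdGraph 7) 0 p ≤ 2 * (1 - (1 / 2 : ℝ) ^ 94896) ^ ((logStar 2 n - 6) / 2) +
        392 * (2 * n + 1 : ℝ) ^ 7 * ((p : ℝ) - criticalProbI 7) ^ 2 := by
  obtain ⟨hlo, hhi⟩ := PkSharp.theta_two_sided_of_scaleDefect (d := 7) (by norm_num) (sixScaleDefect_criticalProbI_orbit (d := 7) (by norm_num))
    (fun m => le_epsLHi _ 7 m) (fun m => epsLHi_le_knLHi (d := 7) (by norm_num) knEps_le_half_pow_six (by norm_num) m) (by positivity)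
    orbit_six_seven_sharp.1.le (epsOrbitDefect_half_pow_le_one (by norm_num) 6) (knShiftC_eq_six_of_le32 (d := 7) (by norm_num) (by norm_num)).le p hpc hp n
  refine ⟨hlo, ?_⟩
  have e : (8 : ℝ) * ((7 : ℕ) : ℝ) ^ 2 = 392 := by norm_num
  rw [e] at hhi
  exact hhi

/-- **`ℤ⁸` at `2⁻⁶`**: `π_{p_c(ℤ⁸)}(N) ≤ (1 − 2⁻²¹⁸²⁹⁶)^⌊(log*₂ N − 6)/2⌋` (at `2⁻⁸`: `2⁻²⁴⁴⁰⁵⁸`).  An explicit function tending to `0` and nothing more.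
builds on p205010 (kernel theorem, internal audit signed; external expert review pending). [cite: KozmaNitzan2024, §4 Theorem 6] -/
theorem oneArm_rate_Z8_six_sharp (N : ℕ) :
    oneArmProb 8 (criticalProbI 8) N ≤ (1 - (1 / 2 : ℝ) ^ 218296) ^ ((logStar 2 N - 6) / 2) :=
  PkSharp.oneArm_le_base_pow_of_scaleDefect (by norm_num) (sixScaleDefect_criticalProbI_orbit (d := 8) (by norm_num)) (fun m => le_epsLHi _ 8 m)
    (fun m => epsLHi_le_knLHi (d := 8) (by norm_num) knEps_le_half_pow_six (by norm_num) m) (by positivity) orbit_six_eight_sharp.1.le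
    (epsOrbitDefect_half_pow_le_one (by norm_num) 6) (knShiftC_eq_six_of_le32 (d := 8) (by norm_num) (by norm_num)).le N

/-- **`ℤ⁸` at `2⁻⁶`, `θ` two-sided**: `p − p_c ≤ θ(p) ≤ 2(1 − 2⁻²¹⁸²⁹⁶)^⌊(log*₂ n − 6)/2⌋ + 512(2n+1)⁸(p − p_c)²` on `[p_c, p_c + 1/4]`.
builds on p205010 (kernel theorem, internal audit signed; external expert review pending). [cite: DuminilCopinTassionEM2016, Thm. 1.1(2)] -/
theorem theta_two_sided_Z8_six_sharp (p : unitInterval) (hpc : (criticalProbI 8 : ℝ) ≤ p) (hp : (p : ℝ) ≤ criticalProbI 8 + 1 / 4) (n : ℕ) :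
    (p : ℝ) - criticalProbI 8 ≤ theta (zdGraph 8) 0 p ∧
      theta (zdGraph 8) 0 p ≤ 2 * (1 - (1 / 2 : ℝ) ^ 218296) ^ ((logStar 2 n - 6) / 2) +
        512 * (2 * n + 1 : ℝ) ^ 8 * ((p : ℝ) - criticalProbI 8) ^ 2 := by
  obtain ⟨hlo, hhi⟩ := PkSharp.theta_two_sided_of_scaleDefect (d := 8) (by norm_num) (sixScaleDefect_criticalProbI_orbit (d := 8) (by norm_num))
    (fun m => le_epsLHi _ 8 m) (fun m => epsLHi_le_knLHi (d := 8) (by norm_num) knEps_le_half_pow_six (by norm_num) m) (by positivity)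
    orbit_six_eight_sharp.1.le (epsOrbitDefect_half_pow_le_one (by norm_num) 6) (knShiftC_eq_six_of_le32 (d := 8) (by norm_num) (by norm_num)).le p hpc hp n
  refine ⟨hlo, ?_⟩
  have e : (8 : ℝ) * ((8 : ℕ) : ℝ) ^ 2 = 512 := by norm_num
  rw [e] at hhi
  exact hhi

/-- **`ℤ⁹` at `2⁻⁶`**: `π_{p_c(ℤ⁹)}(N) ≤ (1 − 2⁻⁴⁹³⁹⁶⁸)^⌊(log*₂ N − 6)/2⌋` (at `2⁻⁸`: `2⁻⁵⁵¹⁹³¹`).  An explicit function tending to `0` and nothing more.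
builds on p205010 (kernel theorem, internal audit signed; external expert review pending). [cite: KozmaNitzan2024, §4 Theorem 6] -/
theorem oneArm_rate_Z9_six_sharp (N : ℕ) :
    oneArmProb 9 (criticalProbI 9) N ≤ (1 - (1 / 2 : ℝ) ^ 493968) ^ ((logStar 2 N - 6) / 2) :=
  PkSharp.oneArm_le_base_pow_of_scaleDefect (by norm_num) (sixScaleDefect_criticalProbI_orbit (d := 9) (by norm_num)) (fun m => le_epsLHi _ 9 m)
    (fun m => epsLHi_le_knLHi (d := 9) (by norm_num) knEps_le_half_pow_six (by norm_num) m) (by positivity) orbit_six_nine_sharp.1.le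
    (epsOrbitDefect_half_pow_le_one (by norm_num) 6) (knShiftC_eq_six_of_le32 (d := 9) (by norm_num) (by norm_num)).le N

/-- **`ℤ⁹` at `2⁻⁶`, `θ` two-sided**: `p − p_c ≤ θ(p) ≤ 2(1 − 2⁻⁴⁹³⁹⁶⁸)^⌊(log*₂ n − 6)/2⌋ + 648(2n+1)⁹(p − p_c)²` on `[p_c, p_c + 1/4]`.
builds on p205010 (kernel theorem, internal audit signed; external expert review pending). [cite: DuminilCopinTassionEM2016, Thm. 1.1(2)] -/
theorem theta_two_sided_Z9_six_sharp (p : unitInterval) (hpc : (criticalProbI 9 : ℝ) ≤ p) (hp : (p : ℝ) ≤ criticalProbI 9 + 1 / 4) (n : ℕ) :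
    (p : ℝ) - criticalProbI 9 ≤ theta (zdGraph 9) 0 p ∧
      theta (zdGraph 9) 0 p ≤ 2 * (1 - (1 / 2 : ℝ) ^ 493968) ^ ((logStar 2 n - 6) / 2) +
        648 * (2 * n + 1 : ℝ) ^ 9 * ((p : ℝ) - criticalProbI 9) ^ 2 := by
  obtain ⟨hlo, hhi⟩ := PkSharp.theta_two_sided_of_scaleDefect (d := 9) (by norm_num) (sixScaleDefect_criticalProbI_orbit (d := 9) (by norm_num))
    (fun m => le_epsLHi _ 9 m) (fun m => epsLHi_le_knLHi (d := 9) (by norm_num) knEps_le_half_pow_six (by norm_num) m) (by positivity)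
    orbit_six_nine_sharp.1.le (epsOrbitDefect_half_pow_le_one (by norm_num) 6) (knShiftC_eq_six_of_le32 (d := 9) (by norm_num) (by norm_num)).le p hpc hp n
  refine ⟨hlo, ?_⟩
  have e : (8 : ℝ) * ((9 : ℕ) : ℝ) ^ 2 = 648 := by norm_num
  rw [e] at hhi
  exact hhi

/-- **`ℤ¹⁰` at `2⁻⁶`**: `π_{p_c(ℤ¹⁰)}(N) ≤ (1 − 2⁻¹¹⁰³³³⁸)^⌊(log*₂ N − 6)/2⌋` (at `2⁻⁸`: `2⁻¹²³²¹⁴⁵`).  An explicit function tending to `0` and nothing more.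
builds on p205010 (kernel theorem, internal audit signed; external expert review pending). [cite: KozmaNitzan2024, §4 Theorem 6] -/
theorem oneArm_rate_Z10_six_sharp (N : ℕ) :
    oneArmProb 10 (criticalProbI 10) N ≤ (1 - (1 / 2 : ℝ) ^ 1103338) ^ ((logStar 2 N - 6) / 2) :=
  PkSharp.oneArm_le_base_pow_of_scaleDefect (by norm_num) (sixScaleDefect_criticalProbI_orbit (d := 10) (by norm_num)) (fun m => le_epsLHi _ 10 m)
    (fun m => epsLHi_le_knLHi (d := 10) (by norm_num) knEps_le_half_pow_six (by norm_num) m) (by positivity) orbit_six_ten_sharp.1.le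
    (epsOrbitDefect_half_pow_le_one (by norm_num) 6) (knShiftC_eq_six_of_le32 (d := 10) (by norm_num) (by norm_num)).le N

/-- **`ℤ¹⁰` at `2⁻⁶`, `θ` two-sided**: `p − p_c ≤ θ(p) ≤ 2(1 − 2⁻¹¹⁰³³³⁸)^⌊(log*₂ n − 6)/2⌋ + 800(2n+1)¹⁰(p − p_c)²` on `[p_c, p_c + 1/4]`.
builds on p205010 (kernel theorem, internal audit signed; external expert review pending). [cite: DuminilCopinTassionEM2016, Thm. 1.1(2)] -/
theorem theta_two_sided_Z10_six_sharp (p : unitInterval) (hpc : (criticalProbI 10 : ℝ) ≤ p) (hp : (p : ℝ) ≤ criticalProbI 10 + 1 / 4) (n : ℕ) :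
    (p : ℝ) - criticalProbI 10 ≤ theta (zdGraph 10) 0 p ∧
      theta (zdGraph 10) 0 p ≤ 2 * (1 - (1 / 2 : ℝ) ^ 1103338) ^ ((logStar 2 n - 6) / 2) +
        800 * (2 * n + 1 : ℝ) ^ 10 * ((p : ℝ) - criticalProbI 10) ^ 2 := by
  obtain ⟨hlo, hhi⟩ := PkSharp.theta_two_sided_of_scaleDefect (d := 10) (by norm_num) (sixScaleDefect_criticalProbI_orbit (d := 10) (by norm_num))
    (fun m => le_epsLHi _ 10 m) (fun m => epsLHi_le_knLHi (d := 10) (by norm_num) knEps_le_half_pow_six (by norm_num) m) (by positivity)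
    orbit_six_ten_sharp.1.le (epsOrbitDefect_half_pow_le_one (by norm_num) 6) (knShiftC_eq_six_of_le32 (d := 10) (by norm_num) (by norm_num)).le p hpc hp n
  refine ⟨hlo, ?_⟩
  have e : (8 : ℝ) * ((10 : ℕ) : ℝ) ^ 2 = 800 := by norm_num
  rw [e] at hhi
  exact hhi

end Summit.CriticalPhenomena.PercolationContinuityZ3.Theorems.Quant.EpsSharp

end
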